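import Mathlib.Analysis.SpecialFunctions.Pow.Deriv
import Mathlib.Analysis.SpecialFunctions.Complex.LogDeriv
import HarnessLib

/-!
# The near-horizon ("throat") limit of the scalar radial Teukolsky equation on near-extremal Kerr is
# hypergeometric (Teukolsky–Press 1974 / Bardeen–Horowitz near-NHEK), Boyer–Lindquist form

In the blown-up radius `x = (r − r₊)/(r₊ − r₋)` the scalar (`s = 0`) radial Teukolsky/Carter equation of
sub-extremal Kerr is `(x(x+1)R′)′ + [k(x)²/(x(x+1)) − Λ′]R = 0`, `k = ξ + ωx(2r₊ + (r₊−r₋)x)`,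
`ξ = (ω − mΩ_H)/2κ` (tree: `…Theorems.KappaExplicitWaveDecay.OlverDunsterUniformReduction.stub_olverNormalForm`,
Liouville form). Letting `r₊ − r₋ → 0` at fixed `(x, ξ)` gives the THROAT (near-NHEK) equation

  `x(x+1)R″ + (2x+1)R′ + [(ξ + m̂x)²/(x(x+1)) − L] R = 0`,   `m̂ = lim 2ωr₊`, `L = lim Λ′`,        (∗)

three regular singular points `0, −1, ∞` with exponents `∓iξ`, `∓i(ξ − m̂)`, `−½ ± iδ`, `δ² = m̂² − L − ¼`.
Teukolsky–Press (1974, §III / App. A; ingoing coordinates) and Bardeen–Horowitz (1999) solve it by `₂F₁`.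
This file proves the Boyer–Lindquist-form statement behind that:

* `throat_of_hypergeometric` — if `g` satisfies the hypergeometric equation in the variable `z = −x`,
  `x(1+x)g″ + (c + (a+b+1)x)g′ + ab·g = 0` at `x > 0`, where `a = ½ − i(2ξ − m̂) − iδ`,
  `b = ½ − i(2ξ − m̂) + iδ`, `c = 1 − 2iξ`, so that `c + (a+b+1)x = (1 − 2iξ) + (2 − 2i(2ξ − m̂))x` and
  `ab = (½ − i(2ξ − m̂))² + δ² = (½ − i(2ξ − m̂))² + m̂² − L − ¼` (only `δ²` enters), and `P′ = φP` with
  `φ = −iξ/x − i(ξ − m̂)/(1+x)` (the logarithmic derivative of `x^{−iξ}(1+x)^{−i(ξ−m̂)}`), then `R = P·g`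
  solves (∗) — chain rule + two polynomial identities;
* `hasDerivAt_throatPrefactor` — `P(x) = x^{−iξ}(1+x)^{−i(ξ−m̂)}` (principal powers) has `P′ = φP` on `x > 0`;
* `throatSolution_of_hypergeometric` — the two combined.

With Mathlib's `ordinaryHypergeometric a b c (−x)` for `g` on `0 < x < 1` this is the horizon-INGOING
throat solution `R_in` (unit at `x = 0`, behaviour `x^{−iξ}`); its continuation to `x → ∞` carries the
Teukolsky–Press connection coefficients (`TeukolskyPressNearExtremalAmplitudes.lean`; Euler transformation:
`(a, b, c) = (c − α₊, c − α₋, c)` for GZZ's `α± = ½ ± iδ − im̂`). Nothing asymptotic is claimed here.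

References: S. A. Teukolsky, W. H. Press, ApJ 193 (1974) 443 [TeukolskyPress1974]; S. E. Gralla,
A. Zimmerman, P. Zimmerman, arXiv:1608.04739 §2.2 [GrallaZimmermanZimmerman2016].
-/

noncomputable section

open Complex

namespace Literature.Geometry.Lorentzian.Kerr.TeukolskyPress

/-- Logarithmic derivative `φ(x) = −iξ/x − i(ξ − m̂)/(1 + x)` of the throat prefactor
`x^{−iξ}(1+x)^{−i(ξ−m̂)}`. [cite: TeukolskyPress1974, Section III] -/
def throatLogDeriv (ξ mh : ℝ) (x : ℝ) : ℂ :=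
  -(I * ξ) / (x : ℂ) - I * (ξ - mh) / (1 + (x : ℂ))

/-- Derivative of `throatLogDeriv`: `φ′(x) = iξ/x² + i(ξ − m̂)/(1+x)²`. [folklore] -/
def throatLogDeriv' (ξ mh : ℝ) (x : ℝ) : ℂ :=
  I * ξ / (x : ℂ) ^ 2 + I * (ξ - mh) / (1 + (x : ℂ)) ^ 2

/-- `φ` is differentiable on `x > 0` with derivative `φ′`. [folklore] -/
theorem hasDerivAt_throatLogDeriv (ξ mh : ℝ) {x : ℝ} (hx : 0 < x) :
    HasDerivAt (throatLogDeriv ξ mh) (throatLogDeriv' ξ mh x) x := by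
  have hx0 : (x : ℂ) ≠ 0 := by exact_mod_cast hx.ne'
  have hx1 : (1 + (x : ℂ)) ≠ 0 := by
    have : ((1 + x : ℝ) : ℂ) ≠ 0 := by exact_mod_cast (by linarith : (1 + x : ℝ) ≠ 0)
    simpa using this
  -- derivatives of the two complex maps `z ↦ z⁻¹`, `z ↦ (1 + z)⁻¹` at `z = x`, pulled back to `ℝ`
  have hinv1 : HasDerivAt (fun y : ℝ => ((y : ℂ))⁻¹) (-((x : ℂ) ^ 2)⁻¹) x :=
    (hasDerivAt_inv hx0).comp_ofReal
  have h2c : HasDerivAt (fun z : ℂ => (1 + z)⁻¹) (-(1 : ℂ) / (1 + (x : ℂ)) ^ 2) (x : ℂ) := by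
    have h := ((hasDerivAt_id (x : ℂ)).const_add 1).inv hx1
    simp only [id] at h
    exact h
  have hinv2 : HasDerivAt (fun y : ℝ => (1 + (y : ℂ))⁻¹) (-(1 : ℂ) / (1 + (x : ℂ)) ^ 2) x := h2c.comp_ofReal
  have hsum := (hinv1.const_mul (-(I * ξ))).sub (hinv2.const_mul (I * (ξ - mh)))
  have e1 : throatLogDeriv ξ mh = fun y : ℝ => -(I * ξ) * ((y : ℂ))⁻¹ - I * (ξ - mh) * (1 + (y : ℂ))⁻¹ := by
    funext y; simp only [throatLogDeriv, div_eq_mul_inv]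
  have e2 : throatLogDeriv' ξ mh x = -(I * ξ) * -((x : ℂ) ^ 2)⁻¹ - I * (ξ - mh) * (-(1 : ℂ) / (1 + (x : ℂ)) ^ 2) := by
    unfold throatLogDeriv'; ring
  rw [e1, e2]
  exact hsum

/-- `x(1+x)·φ(x) = −i(ξ + (2ξ − m̂)x)`. [folklore] -/
theorem mul_throatLogDeriv (ξ mh : ℝ) {x : ℝ} (hx : 0 < x) :
    (x : ℂ) * (1 + x) * throatLogDeriv ξ mh x = -I * (ξ + (2 * ξ - mh) * x) := by
  have hx0 : (x : ℂ) ≠ 0 := by exact_mod_cast hx.ne'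
  have hx1 : (1 + (x : ℂ)) ≠ 0 := by
    have : ((1 + x : ℝ) : ℂ) ≠ 0 := by exact_mod_cast (by linarith : (1 + x : ℝ) ≠ 0)
    simpa using this
  unfold throatLogDeriv
  field_simp
  ring

/-- `x²(1+x)²·φ′(x) = i(ξ(1+x)² + (ξ − m̂)x²)`. [folklore] -/
theorem mul_throatLogDeriv' (ξ mh : ℝ) {x : ℝ} (hx : 0 < x) :
    (x : ℂ) ^ 2 * (1 + x) ^ 2 * throatLogDeriv' ξ mh x = I * (ξ * (1 + x) ^ 2 + (ξ - mh) * x ^ 2) := by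
  have hx0 : (x : ℂ) ≠ 0 := by exact_mod_cast hx.ne'
  have hx1 : (1 + (x : ℂ)) ≠ 0 := by
    have : ((1 + x : ℝ) : ℂ) ≠ 0 := by exact_mod_cast (by linarith : (1 + x : ℝ) ≠ 0)
    simpa using this
  unfold throatLogDeriv'
  field_simp

/-- **The throat equation is hypergeometric (chain-rule core).** With `s := 2ξ − m̂`: if at `x > 0`
`g` satisfies `x(1+x)g″ + ((1 − 2iξ) + (2 − 2is)x)g′ + ((½ − is)² + (m̂² − L − ¼))g = 0` — the
`₂F₁(a, b; c; −x)` equation with `a, b = ½ − is ∓ iδ`, `c = 1 − 2iξ`, `δ² = m̂² − L − ¼` — and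
`P′ = φ(x)P` (`φ = throatLogDeriv`), then `R = P·g` satisfies the throat equation
`x(x+1)R″ + (2x+1)R′ + ((ξ + m̂x)²/(x(x+1)) − L)R = 0` at `x`, with `R′ = P(φg + g′)`,
`R″ = P((φ² + φ′)g + 2φg′ + g″)`. [cite: TeukolskyPress1974, Section III] -/
theorem throat_of_hypergeometric {ξ mh L : ℝ} {g g' g'' P : ℝ → ℂ} {x : ℝ} (hx : 0 < x)
    (hg : HasDerivAt g (g' x) x) (hg' : HasDerivAt g' (g'' x) x)
    (hP : HasDerivAt P (throatLogDeriv ξ mh x * P x) x)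
    (hyp : (x : ℂ) * (1 + x) * g'' x + ((1 - 2 * ξ * I) + (2 - 2 * (2 * ξ - mh) * I) * x) * g' x +
      ((1 / 2 - (2 * ξ - mh) * I) ^ 2 + ((mh : ℂ) ^ 2 - L - 1 / 4)) * g x = 0) :
    HasDerivAt (fun y => P y * g y) (P x * (throatLogDeriv ξ mh x * g x + g' x)) x ∧
    HasDerivAt (fun y => P y * (throatLogDeriv ξ mh y * g y + g' y))
      (P x * ((throatLogDeriv ξ mh x ^ 2 + throatLogDeriv' ξ mh x) * g x +
        2 * throatLogDeriv ξ mh x * g' x + g'' x)) x ∧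
    (x : ℂ) * (x + 1) * (P x * ((throatLogDeriv ξ mh x ^ 2 + throatLogDeriv' ξ mh x) * g x +
        2 * throatLogDeriv ξ mh x * g' x + g'' x)) +
      (2 * x + 1) * (P x * (throatLogDeriv ξ mh x * g x + g' x)) +
      ((((ξ : ℂ) + mh * x) ^ 2 / ((x : ℂ) * (x + 1)) - L) * (P x * g x)) = 0 := by
  have hφ := hasDerivAt_throatLogDeriv ξ mh hx
  refine ⟨?_, ?_, ?_⟩
  · exact (hP.mul hg).congr_deriv (by ring)
  · have h1 : HasDerivAt (fun y => throatLogDeriv ξ mh y * g y + g' y)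
        (throatLogDeriv' ξ mh x * g x + throatLogDeriv ξ mh x * g' x + g'' x) x := (hφ.mul hg).add hg'
    exact (hP.mul h1).congr_deriv (by ring)
  · have hx0 : (x : ℂ) ≠ 0 := by exact_mod_cast hx.ne'
    have hx1 : (x : ℂ) + 1 ≠ 0 := by
      have : ((x + 1 : ℝ) : ℂ) ≠ 0 := by exact_mod_cast (by linarith : (x + 1 : ℝ) ≠ 0)
      simpa using this
    have hxx : (x : ℂ) * (x + 1) ≠ 0 := mul_ne_zero hx0 hx1
    set φ := throatLogDeriv ξ mh x with hφdef
    set φ' := throatLogDeriv' ξ mh x with hφ'def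
    have hn1 : (x : ℂ) * (x + 1) * φ = -I * (ξ + (2 * ξ - mh) * x) := by
      rw [show (x : ℂ) * (x + 1) = (x : ℂ) * (1 + x) by ring]; exact mul_throatLogDeriv ξ mh hx
    have hn2 : ((x : ℂ) * (x + 1)) ^ 2 * φ' = I * (ξ * (1 + x) ^ 2 + (ξ - mh) * x ^ 2) := by
      rw [show ((x : ℂ) * (x + 1)) ^ 2 = (x : ℂ) ^ 2 * (1 + x) ^ 2 by ring]; exact mul_throatLogDeriv' ξ mh hx
    -- multiply the claim by (x(x+1))² ≠ 0 and reduce to a polynomial identity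
    have hdiv : ((ξ : ℂ) + mh * x) ^ 2 / ((x : ℂ) * (x + 1)) * ((x : ℂ) * (x + 1)) = ((ξ : ℂ) + mh * x) ^ 2 :=
      div_mul_cancel₀ _ hxx
    apply (mul_eq_zero.1 (?_ : _ * (((x : ℂ) * (x + 1)) ^ 2) = 0)).resolve_right (pow_ne_zero 2 hxx)
    -- target: LHS * (x(x+1))² = 0
    have expand : ((x : ℂ) * (x + 1) * (P x * ((φ ^ 2 + φ') * g x + 2 * φ * g' x + g'' x)) +
        (2 * x + 1) * (P x * (φ * g x + g' x)) +
        ((((ξ : ℂ) + mh * x) ^ 2 / ((x : ℂ) * (x + 1)) - L) * (P x * g x))) * ((x : ℂ) * (x + 1)) ^ 2 =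
        P x * ( (((x : ℂ) * (x + 1) * φ) ^ 2 + ((x : ℂ) * (x + 1)) ^ 2 * φ' +
                  (2 * x + 1) * ((x : ℂ) * (x + 1) * φ) +
                  ((ξ : ℂ) + mh * x) ^ 2 / ((x : ℂ) * (x + 1)) * ((x : ℂ) * (x + 1)) - L * ((x : ℂ) * (x + 1)))
                  * ((x : ℂ) * (x + 1)) * g x
              + (2 * ((x : ℂ) * (x + 1) * φ) + (2 * x + 1)) * ((x : ℂ) * (x + 1)) ^ 2 * g' x
              + ((x : ℂ) * (x + 1)) ^ 2 * ((x : ℂ) * (x + 1) * g'' x) ) := by ring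
    rw [expand, hdiv, hn1, hn2]
    -- substitute the hypergeometric relation for x(x+1) g''
    have hgpp : (x : ℂ) * (x + 1) * g'' x = -(((1 - 2 * ξ * I) + (2 - 2 * (2 * ξ - mh) * I) * x) * g' x) -
        ((1 / 2 - (2 * ξ - mh) * I) ^ 2 + ((mh : ℂ) ^ 2 - L - 1 / 4)) * g x := by
      rw [show (x : ℂ) * (x + 1) = (x : ℂ) * (1 + x) by ring]; linear_combination hyp
    rw [hgpp]
    linear_combination (P x * g x * ((x : ℂ) * (x + 1)) *
      ((((ξ : ℂ) + (2 * ξ - mh) * x) ^ 2) - (2 * ξ - mh) ^ 2 * ((x : ℂ) * (x + 1)))) * Complex.I_sq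

/-- **The throat prefactor** `P(x) = x^{−iξ}(1+x)^{−i(ξ−m̂)}` (principal complex powers of the positive
reals `x`, `1 + x`) satisfies `P′ = φP` on `x > 0`. [folklore] -/
theorem hasDerivAt_throatPrefactor (ξ mh : ℝ) {x : ℝ} (hx : 0 < x) :
    HasDerivAt (fun y : ℝ => (y : ℂ) ^ (-(I * ξ)) * (1 + (y : ℂ)) ^ (-(I * (ξ - mh))))
      (throatLogDeriv ξ mh x * ((x : ℂ) ^ (-(I * ξ)) * (1 + (x : ℂ)) ^ (-(I * (ξ - mh))))) x := by
  have hx0 : (x : ℂ) ≠ 0 := by exact_mod_cast hx.ne'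
  have hx1r : (0 : ℝ) < 1 + x := by linarith
  have hx1 : (1 + (x : ℂ)) ≠ 0 := by
    have : ((1 + x : ℝ) : ℂ) ≠ 0 := by exact_mod_cast hx1r.ne'
    simpa using this
  have hslit0 : (x : ℂ) ∈ Complex.slitPlane := Complex.ofReal_mem_slitPlane.2 hx
  have hslit1 : (1 + (x : ℂ)) ∈ Complex.slitPlane := by
    have : ((1 + x : ℝ) : ℂ) ∈ Complex.slitPlane := Complex.ofReal_mem_slitPlane.2 hx1r
    simpa using this
  have hA : HasDerivAt (fun y : ℝ => (y : ℂ) ^ (-(I * ξ))) (-(I * ξ) * (x : ℂ) ^ (-(I * ξ) - 1)) x := by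
    have h := (Complex.hasStrictDerivAt_cpow_const (c := -(I * ξ)) hslit0).hasDerivAt
    exact h.comp_ofReal
  have hB : HasDerivAt (fun y : ℝ => (1 + (y : ℂ)) ^ (-(I * (ξ - mh))))
      (-(I * (ξ - mh)) * (1 + (x : ℂ)) ^ (-(I * (ξ - mh)) - 1) * 1) x := by
    have h := ((hasDerivAt_id (x : ℂ)).const_add 1).cpow_const (c := -(I * (ξ - mh))) hslit1
    exact h.comp_ofReal
  have hAB := hA.mul hB
  -- `w x^{w-1} = (w/x) x^w`
  have eA : (x : ℂ) ^ (-(I * ξ) - 1) = (x : ℂ) ^ (-(I * ξ)) / x := by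
    rw [Complex.cpow_sub _ _ hx0, Complex.cpow_one]
  have eB : (1 + (x : ℂ)) ^ (-(I * (ξ - mh)) - 1) = (1 + (x : ℂ)) ^ (-(I * (ξ - mh))) / (1 + (x : ℂ)) := by
    rw [Complex.cpow_sub _ _ hx1, Complex.cpow_one]
  have key : -(I * ξ) * (x : ℂ) ^ (-(I * ξ) - 1) * (1 + (x : ℂ)) ^ (-(I * (ξ - mh))) +
      (x : ℂ) ^ (-(I * ξ)) * (-(I * (ξ - mh)) * (1 + (x : ℂ)) ^ (-(I * (ξ - mh)) - 1) * 1) =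
      throatLogDeriv ξ mh x * ((x : ℂ) ^ (-(I * ξ)) * (1 + (x : ℂ)) ^ (-(I * (ξ - mh)))) := by
    rw [eA, eB]
    unfold throatLogDeriv
    field_simp
    ring
  exact hAB.congr_deriv key

/-- **Throat solutions from hypergeometric ones.** If `g` solves the `₂F₁(a, b; c; −x)` equation of
`throat_of_hypergeometric` at `x > 0`, then `R(x) = x^{−iξ}(1+x)^{−i(ξ−m̂)} g(x)` solves the throat
equation `x(x+1)R″ + (2x+1)R′ + ((ξ + m̂x)²/(x(x+1)) − L)R = 0` at `x`. For `g = ₂F₁(a,b;c;−x)`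
(`|x| < 1`) this is the horizon-ingoing solution `~ x^{−iξ}` of Teukolsky–Press.
[cite: TeukolskyPress1974, Section III] -/
theorem throatSolution_of_hypergeometric {ξ mh L : ℝ} {g g' g'' : ℝ → ℂ} {x : ℝ} (hx : 0 < x)
    (hg : HasDerivAt g (g' x) x) (hg' : HasDerivAt g' (g'' x) x)
    (hyp : (x : ℂ) * (1 + x) * g'' x + ((1 - 2 * ξ * I) + (2 - 2 * (2 * ξ - mh) * I) * x) * g' x +
      ((1 / 2 - (2 * ξ - mh) * I) ^ 2 + ((mh : ℂ) ^ 2 - L - 1 / 4)) * g x = 0) :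
    ∃ R' R'' : ℂ,
      HasDerivAt (fun y : ℝ => (y : ℂ) ^ (-(I * ξ)) * (1 + (y : ℂ)) ^ (-(I * (ξ - mh))) * g y) R' x ∧
      HasDerivAt (fun y : ℝ => (y : ℂ) ^ (-(I * ξ)) * (1 + (y : ℂ)) ^ (-(I * (ξ - mh))) *
          (throatLogDeriv ξ mh y * g y + g' y)) R'' x ∧
      R' = (x : ℂ) ^ (-(I * ξ)) * (1 + (x : ℂ)) ^ (-(I * (ξ - mh))) * (throatLogDeriv ξ mh x * g x + g' x) ∧
      (x : ℂ) * (x + 1) * R'' + (2 * x + 1) * R' +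
        (((ξ : ℂ) + mh * x) ^ 2 / ((x : ℂ) * (x + 1)) - L) *
          ((x : ℂ) ^ (-(I * ξ)) * (1 + (x : ℂ)) ^ (-(I * (ξ - mh))) * g x) = 0 := by
  obtain ⟨h1, h2, h3⟩ := throat_of_hypergeometric hx hg hg' (hasDerivAt_throatPrefactor ξ mh hx) hyp
  exact ⟨_, _, h1, h2, rfl, h3⟩

end Literature.Geometry.Lorentzian.Kerr.TeukolskyPress

end
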